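import Summits.CriticalPhenomena.SAWScalingLimit.Theses.SAWDevelopingMap
import Summits.CriticalPhenomena.SAWScalingLimit.Theses.SAWResidueField
import Summits.CriticalPhenomena.SAWScalingLimit.Cruxes.HexTight.Disproof
import Summits.CriticalPhenomena.SAWScalingLimit.Theorems.HexTight.Negative.NotRenewalGluing
import Literature.Barriers.CriticalPhenomena.ParafermionicHalfCauchyRiemann

/-!
# Line `differentiated-sum-rule` — skeleton for the crux `HexTight` (stmt-CriticalPhenomena-5423)

Crux (FIXED, by name): `Summit.CriticalPhenomena.SAWScalingLimit.Theses.SAWDevelopingMap.HexTight`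
(eventual Billingsley tightness of the critical hexagonal SAW laws; shared by the routes
SAWDevelopingMap / SAWResidueField / SAWWindingAlias / SAWPhaseRetrieval).

IDEA (card `Cruxes/HexTight/Ideas/differentiated-sum-rule.md`, triage r1: 3 × pass). Differentiate
the Duminil-Copin–Smirnov sum rule in the DOMAIN: for `U ⊆ Λ` and a boundary source `a` of both `Λ`
and `Λ ∖ U`, the difference `D = F^Λ_a − F^{Λ∖U}_a` of the two critical parafermionic observables
satisfies Lemma 1 at every vertex of `Λ ∖ U` with NO source term, and the discrete Green identity
(`Literature.Barriers.CriticalPhenomena.HexGreen.sum_relations_eq_hexFlux`, PROVED) gives the exact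
STRONG-MARKOV IDENTITY `MAIN(D) = DOOR(F^{Λ∖U}) − WALL(F^Λ)`: the phase-weighted `x_c`-mass of the
arcs from `a` that VISIT `U` and come back to exit elsewhere equals a door term minus a wall term,
all boundary values. Per walk the phase is `d_a · e^{i(3/8)W(γ)}` EXACTLY (final tangent = initial
tangent rotated by the winding — the definition of `winding`, no Umlaufsatz needed), whence the
signed inequality `stub_signedVisitingBound` (the LEVER, provable now).

WHAT THE LEVER BUYS AND WHAT IT CANNOT (analysis of this plan, NOTES.md "Analysis log"). The
identity bounds TWO-WAY mass (visit `U` and return) by ONE-WAY mass (walks ENDING at `U`'s door or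
walls). This is effective exactly when one-way enders into `U` are rare relative to the normaliser:
`U` = a small ball far from the tip (exponent ≈ 1, matching the SLE(8/3) return exponent near a
hairpin bend) — the INWARD, arch-free half of Kemppainen–Smirnov's Condition G2 — and it is blind to
OUTWARD unforced excursions into adjacent widening dead ends (re-ascents under self-made arches:
from a tip the one-way far mass `Σ_d d^{-15/16}` is not rare). Aizenman–Burchard's (H1) needs both
halves (an arch + oscillations adversary defeats either half alone), so the outward half is the
independent stub `stub_outwardDive`. Every domain-Markov decomposition produces ratios PINNED at the
target `b`, while the identity controls ARC sums: the pinned transfer `stub_pinnedReturn_of`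
(cross-cut boundary Harnack for SAW partition functions / the change of measure of card
`continuation-value-reverse-holder`, triage: Gehring does NOT apply, use RH′) is unavoidable and also
carries the lattice dictionary (induced `Finset` domains of `ℍ` ↔ the slit graphs of
`hexDomainGraph`; wild Jordan domains with sub-mesh inward fingers = "walls ≠ pinholes", triage r1-3 G2).

SKELETON (6 registered stubs; composition `HexTight_of` kernel-checked through the disprover's
PROVED Aizenman–Burchard rung `Disproof.crux_of_traversalBound`, `Cruxes/HexTight/Disproof.lean` §6):
* `stub_signedVisitingBound : SignedVisitingBound` — lever (M, provable now);
* `stub_farMassDecay : FarMassDecay` — (CD) one-way decay into a small far ball, far-mass normalised;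
* `stub_ballReturn_of : SignedVisitingBound → FarMassDecay → BallReturnBound` — identity ⇒ inward
  visiting bound (coherence management of exit phase classes; the card's falsifier (i) lives here);
* `stub_pinnedReturn_of : BallReturnBound → PinnedReturnBound` — pinned transfer + dictionary;
* `stub_outwardDive : OutwardDiveBound` — KS-G2, constant form, OUTWARD unforced crossings;
* `stub_traversalBound_of : PinnedReturnBound → OutwardDiveBound → AllTraversalBound` — KS17 §2–3 /
  AB99 App. A machinery (nested conditioning through prefix sets, unforced-crossing topology).

DISPROOF USED (`Cruxes/HexTight/Disproof.lean`, cdisprove gen 2). `hexTight_false_without_endpointLimits`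
is honoured inside `Disproof.crux_of_traversalBound` itself (the endpoint limits give
`eventually_ne_and_reachable`, then §2b confinement = (H0)); the line's own output is exactly the
§6 rung `HexTraversalBound` for every `(D, a, b)` (`AllTraversalBound`), with constants and threshold
depending on the approximation as `not_hexTightUniformThreshold` (S2) requires; no all-mesh (S1,
negatives stmt-0772) or finite-net (S3) form appears. Landed negative
`Theorems/HexTight/Negative/NotRenewalGluing` (imported): no stub uses renewal gluing with `a = b`;
the cross-cut decomposition foreseen inside `stub_pinnedReturn_of` glues at boundary door mid-edges
distinct from the target (`RenewalGluingNe` shape).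
-/

noncomputable section

open MeasureTheory Filter Topology Set Metric
open Literature.Probability.RandomPlanarGeometry Literature.Probability.RandomPlanarGeometry.SAW
  Literature.Probability.LatticeModels
open Literature.Barriers.CriticalPhenomena
open scoped ENNReal NNReal BigOperators Classical

namespace Summit.CriticalPhenomena.SAWScalingLimit.Cruxes.HexTight.DifferentiatedSumRule

/-! ## A. Lattice objects (induced honeycomb domains `Λ : Finset HexVertex`, lattice units) -/

/-- `x_c = 1/√(2+√2)`. -/
abbrev xc : ℝ := hexCriticalFugacity

/-- The `x_c`-mass `Z_Λ(a → z) = Σ_{γ ⊂ Λ : a → z} x_c^{ℓ(γ)}` of the self-avoiding walks of the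
domain `Λ` between the mid-edges `a` and `z` (`= F(a, z, x_c, 0)`, an upper bound for `|F(a,z,x_c,σ)|`
by `norm_hexParafermionicObservable_le`). -/
def zmass (Λ : Finset HexVertex) (a z : Sym2 HexVertex) : ℝ :=
  ∑ γ : HexMidEdgeSAW Λ a z, xc ^ γ.length

/-- The walk `γ` visits the vertex set `U`. -/
def Visits {Λ : Finset HexVertex} {a z : Sym2 HexVertex} (γ : HexMidEdgeSAW Λ a z)
    (U : Finset HexVertex) : Prop :=
  ∃ y ∈ γ.verts, y ∈ U

/-- Unsigned visiting mass: `Σ_{γ ⊂ Λ : a → z, γ ∩ U ≠ ∅} x_c^{ℓ(γ)}`. -/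
def visitMass (Λ U : Finset HexVertex) (a z : Sym2 HexVertex) : ℝ :=
  ∑ γ : HexMidEdgeSAW Λ a z, if Visits γ U then xc ^ γ.length else 0

/-- Signed visiting mass: `Σ_{γ ⊂ Λ : a → z, γ ∩ U ≠ ∅} cos((3/8)·W_γ − φ) x_c^{ℓ(γ)}` — the real
part, in the direction `φ`, of the MAIN side of the strong-Markov identity after division by the
entrance half-edge vector `d_a` (per walk `(mid(z) − c(v_n)) e^{-i(5/8)W_γ} = d_a e^{i(3/8)W_γ}`). -/
def signedVisitMass (Λ U : Finset HexVertex) (a z : Sym2 HexVertex) (φ : ℝ) : ℝ :=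
  ∑ γ : HexMidEdgeSAW Λ a z,
    if Visits γ U then Real.cos (3 / 8 * γ.winding - φ) * xc ^ γ.length else 0

/-- MAIN side of the identity (signed): sum over the boundary mid-edges `s(y, w)` of `Λ ∖ U` that
LEAVE `Λ` (`y ∈ Λ ∖ U`, `w ∉ Λ`, `w ∼ y`) of the signed `U`-visiting mass of walks of `Λ` from `a`. -/
def mainSigned (Λ U : Finset HexVertex) (a : Sym2 HexVertex) (φ : ℝ) : ℝ :=
  ∑ y ∈ Λ \ U, ∑ w ∈ (HexGreen.nbrs y).filter (fun w => w ∉ Λ), signedVisitMass Λ U a s(y, w) φ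

/-- MAIN side, unsigned: total mass of walks of `Λ` from `a` visiting `U` and ending at ANY exit of
`Λ ∖ U` that leaves `Λ`. -/
def mainVisitMass (Λ U : Finset HexVertex) (a : Sym2 HexVertex) : ℝ :=
  ∑ y ∈ Λ \ U, ∑ w ∈ (HexGreen.nbrs y).filter (fun w => w ∉ Λ), visitMass Λ U a s(y, w)

/-- DOOR mass: `Σ_{p ∈ door(U)} Z_{Λ∖U}(a → p)` over the mid-edges `p = s(y, w)`, `y ∈ Λ ∖ U`,
`w ∈ U` — walks of the SMALLER domain ending at the door of `U` (one-way enders). -/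
def doorMass (Λ U : Finset HexVertex) (a : Sym2 HexVertex) : ℝ :=
  ∑ y ∈ Λ \ U, ∑ w ∈ (HexGreen.nbrs y).filter (fun w => w ∈ U), zmass (Λ \ U) a s(y, w)

/-- WALL mass: `Σ_{q ∈ walls(U)} Z_Λ(a → q)` over the boundary mid-edges `q = s(y, w)` of `Λ` hanging
off `U` (`y ∈ U`, `w ∉ Λ`) — walks of `Λ` ending on the walls of `U` (one-way enders). -/
def wallMass (Λ U : Finset HexVertex) (a : Sym2 HexVertex) : ℝ :=
  ∑ y ∈ U, ∑ w ∈ (HexGreen.nbrs y).filter (fun w => w ∉ Λ), zmass Λ a s(y, w)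

/-- **The lever — signed visiting bound (strong-Markov identity, real part).** For a simply
connected honeycomb domain `Λ`, any `U ⊆ Λ`, a boundary source `a = s(u, v)` (`v ∈ Λ ∖ U`, `u ∉ Λ`)
and any phase `φ`:
`Σ_{main exits h of Λ∖U} Σ_{γ: a → h in Λ, γ visits U} cos((3/8)W_γ − φ) x_c^ℓ ≤ DOOR + WALL`.
Proof sketch (size M, provable now): Lemma 1 for `F^Λ` on `Λ` (`DuminilCopinSmirnov2012_lemma1_holds`)
and for `F^{Λ∖U}` on `Λ ∖ U` (the tree's proof uses simple connectivity only through
`HV.wnd_eq_zero_of_simplyConnected` — "the entrance lies outside every cycle of `Λ`" — which is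
inherited by every `Λ' ⊆ Λ` with the same entrance, so holes in `Λ ∖ U` are allowed); the Green
identity `HexGreen.sum_relations_eq_hexFlux` over `Λ ∖ U` for `D = F^Λ − F^{Λ∖U}` and over `U` for
`F^Λ` with `HexGreen.term_add_term_swap` gives `MAIN(D) = DOOR(F^{Λ∖U}) − WALL(F^Λ)`; walks of `Λ`
with all vertices in `Λ ∖ U` are exactly the walks of `Λ ∖ U` (same weight), so `D(h)` sums the
`U`-visiting walks; per walk `(hexMidpoint h − hexCenter v_n) = d_a · e^{iW_γ}` with
`d_a = (hexCenter v − hexCenter u)/2` (product of the unit ratios of consecutive increments of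
`γ.points`), hence the MAIN term of `γ` is `d_a e^{i(3/8)W_γ} x_c^ℓ`; finally `|term| ≤ |d_a|·zmass`
on door and wall (`norm_hexParafermionicObservable_le`) and `Re ≤ |·|`. -/
def SignedVisitingBound : Prop :=
  ∀ (Λ U : Finset HexVertex), hexDomainSimplyConnected Λ → U ⊆ Λ →
    ∀ (u v : HexVertex), hexGraph.Adj u v → v ∈ Λ → v ∉ U → u ∉ Λ → ∀ φ : ℝ,
      mainSigned Λ U s(u, v) φ ≤ doorMass Λ U s(u, v) + wallMass Λ U s(u, v)

/-! ## B. The σ-geometry: tip outside `B(x, R)`, small ball `B̄(x, ρ)`, truncation at `2R` -/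

/-- The part of `Λ` in the closed ball `B̄(x, r)` (lattice units, positions `hexCenter`). -/
def ballPart (Λ : Finset HexVertex) (x : ℂ) (r : ℝ) : Finset HexVertex :=
  Λ.filter (fun y => dist (hexCenter y) x ≤ r)

/-- Truncation of `Λ` to the open ball `B(x, 2R)` (simply connected if `Λ` is). -/
def trunc (Λ : Finset HexVertex) (x : ℂ) (R : ℝ) : Finset HexVertex :=
  Λ.filter (fun y => dist (hexCenter y) x < 2 * R)

/-- FAR MASS: walks of `Λ₂` from `a` ending at a boundary mid-edge `s(y, w)` of `Λ₂` (`y ∈ Λ₂`,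
`w ∉ Λ₂`: a wall of `Λ`, or the truncation circle) whose midpoint is at distance `≥ R` from `x`.
It contains the trivial walk (`= 1`) when `a` itself is far, and all exits through the circle `2R`. -/
def farMass (Λ₂ : Finset HexVertex) (a : Sym2 HexVertex) (x : ℂ) (R : ℝ) : ℝ :=
  ∑ y ∈ Λ₂, ∑ w ∈ (HexGreen.nbrs y).filter (fun w => w ∉ Λ₂ ∧ R ≤ dist (hexMidpoint s(y, w)) x),
    zmass Λ₂ a s(y, w)

/-- **(CD) far-mass decay — ONE-WAY, observable-friendly.** There are `C` and `a > 0` such that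
for every simply connected `Λ`, boundary source `s(u, v)` with the tip OUTSIDE `B(x, R)`, radii
`1 ≤ ρ`, `2ρ ≤ R`, in the truncated domain `Λ₂ = Λ ∩ B(x, 2R)` with `U = Λ₂ ∩ B̄(x, ρ)`:
`DOOR(U) + WALL(U) ≤ C (ρ/R)^a · FarMass` — the mass of walks ENDING at the rim of, or on walls
inside, the small distant ball is polynomially small compared with the mass ending at distance
`≥ R` from `x`. Heuristic: both sides are boundary-class masses (scale-free ratio); exposed wall
inside `B̄(x, ρ)` has length `≲ ρ`, each far site weighs `R^{-15/16}` from a tip, far mass is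
`≳ R^{1/16}`: ratio `≲ ρ/R`. Flat-geometry instances: `B_T → 0` (`tendsto_stripBlim`, PROVED),
`B_T, D_T ≤ 100 T^{-10^{-10}}` (Krachun–Panagiotis arXiv:2310.17299 Thms 2–3, not in tree). NOT the
refuted-summability facts `stripElim_eq_zero`/`stripBlim_ge` (triage r1-2). Open; size M–L;
cheapest falsifier = transfer-matrix lid functional `E_{T,mT}(x_c)` (card, falsifier (ii)). -/
def FarMassDecay : Prop :=
  ∃ C expo : ℝ, 0 < expo ∧ ∀ (Λ : Finset HexVertex), hexDomainSimplyConnected Λ →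
    ∀ (u v : HexVertex), hexGraph.Adj u v → v ∈ Λ → u ∉ Λ →
      ∀ (x : ℂ) (ρ R : ℝ), 1 ≤ ρ → 2 * ρ ≤ R → R ≤ dist (hexCenter v) x →
        doorMass (trunc Λ x R) (ballPart (trunc Λ x R) x ρ) s(u, v) +
            wallMass (trunc Λ x R) (ballPart (trunc Λ x R) x ρ) s(u, v) ≤
          C * (ρ / R) ^ expo * farMass (trunc Λ x R) s(u, v) x R

/-- **Inward visiting bound (far-mass normalised, TWO-WAY).** Same geometry: the total mass of
walks of `Λ₂` from the tip that VISIT the small distant ball `U = Λ₂ ∩ B̄(x, ρ)` and exit anywhere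
outside it is `≤ C (ρ/R)^a · FarMass`. Robust to forcing (far-mass, not target, normalisation: under
an arch the escape enders are themselves visitors and are dominated by the under-arch far enders).
This is what the lever is FOR: `stub_ballReturn_of` derives it from `SignedVisitingBound` +
`FarMassDecay`. -/
def BallReturnBound : Prop :=
  ∃ C expo : ℝ, 0 < expo ∧ ∀ (Λ : Finset HexVertex), hexDomainSimplyConnected Λ →
    ∀ (u v : HexVertex), hexGraph.Adj u v → v ∈ Λ → u ∉ Λ →
      ∀ (x : ℂ) (ρ R : ℝ), 1 ≤ ρ → 2 * ρ ≤ R → R ≤ dist (hexCenter v) x →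
        mainVisitMass (trunc Λ x R) (ballPart (trunc Λ x R) x ρ) s(u, v) ≤
          C * (ρ / R) ^ expo * farMass (trunc Λ x R) s(u, v) x R

/-! ## C. Machinery-facing statements: the embedded model `hexSAWWeight`, conditioned on a prefix

Everything below is phrased for the ACTUAL law of the crux (`hexSAWWeight Ω δ a b`, walks of
`hexDomainGraph Ω δ`, ANY `Ω : Set ℂ`), conditioning on a past = restricting to the walks with a
given vertex prefix `π` (domain Markov property). No dictionary is needed here; it is owed by
`stub_pinnedReturn_of`. Positions are `δ · hexCenter`. -/

/-- position of a face at mesh `δ` -/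
def pos (δ : ℝ) (y : HexVertex) : ℂ := (δ : ℂ) * hexCenter y

/-- the slit vertex set: everything off the past except its tip -/
def slitSet (π : List HexVertex) : Set HexVertex := {y | y ∉ π.dropLast}

/-- vertices of the slit domain in the open annulus `A(x, r, R)` -/
def annVerts (δ : ℝ) (π : List HexVertex) (x : ℂ) (r R : ℝ) : Set HexVertex :=
  {y | y ∈ slitSet π ∧ r < dist (pos δ y) x ∧ dist (pos δ y) x < R}

/-- `C` is a connected component of the annulus part of the slit graph `Ω_δ ∖ π` (Kemppainen–Smirnov
2017, Def. 2.3: the components of `A ∩ U_τ`). -/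
def IsAnnulusComponent (Ω : Set ℂ) (δ : ℝ) (π : List HexVertex) (x : ℂ) (r R : ℝ)
    (C : Set HexVertex) : Prop :=
  C ⊆ annVerts δ π x r R ∧ C.Nonempty ∧
    (∀ y ∈ C, ∀ y' : HexVertex, y' ∈ annVerts δ π x r R → (hexDomainGraph Ω δ).Adj y y' → y' ∈ C) ∧
    ((hexDomainGraph Ω δ).induce C).Preconnected

/-- `C` is UNFORCED (avoidable): the tip is joined to the target `b` in the slit graph avoiding `C`
(KS 2017, Def. 2.3: "does not disconnect"). In a simply connected slit domain an unforced component
leads into a dead end (every cross-cut separates into exactly two components, Pommerenke Prop. 2.12;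
triage r1-2 (X2)). -/
def Unforced (Ω : Set ℂ) (δ : ℝ) (π : List HexVertex) (tip b : HexVertex) (C : Set HexVertex) : Prop :=
  ∃ p : (hexDomainGraph Ω δ).Walk tip b, ∀ y ∈ p.support, y ∈ slitSet π ∧ y ∉ C

/-- KS's non-vacuity condition `∂B(x, r) ∩ ∂U_τ ≠ ∅`, lattice form: some slit-domain vertex within
`r` of `x` has a honeycomb neighbour that is not a slit-domain neighbour (outside `Ω_δ`, on the past,
or across a dropped edge). -/
def InnerTouchesBoundary (Ω : Set ℂ) (δ : ℝ) (π : List HexVertex) (x : ℂ) (r : ℝ) : Prop :=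
  ∃ y y' : HexVertex, hexGraph.Adj y y' ∧ dist (pos δ y) x ≤ r ∧
    y ∈ embMeshDomain hexGraph hexCenter Ω δ ∧ y ∈ slitSet π ∧
    ¬ ((hexDomainGraph Ω δ).Adj y y' ∧ y' ∈ slitSet π)

/-- The vertex list `l` (a whole SAW), read from index `n₀` (the tip) on, makes an INWARD crossing of
`A(x, r, R)` inside `C`: indices `n₀ ≤ i`, `i + 1 < j`, `l[i]` at distance `≥ R`, `l[j]` at distance
`≤ r`, and every vertex strictly between them in `C`. -/
def FutureCrossesIn (l : List HexVertex) (n₀ : ℕ) (C : Set HexVertex) (δ : ℝ) (x : ℂ) (r R : ℝ) : Prop :=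
  ∃ i j : ℕ, n₀ ≤ i ∧ i + 1 < j ∧
    (∃ y, l[i]? = some y ∧ R ≤ dist (pos δ y) x) ∧
    (∃ y, l[j]? = some y ∧ dist (pos δ y) x ≤ r) ∧
    ∀ k, i < k → k < j → ∃ y, l[k]? = some y ∧ y ∈ C

/-- … an OUTWARD crossing of `A(x, r, R)` inside `C` (from distance `≤ r` to distance `≥ R`). -/
def FutureCrossesOut (l : List HexVertex) (n₀ : ℕ) (C : Set HexVertex) (δ : ℝ) (x : ℂ) (r R : ℝ) : Prop :=
  ∃ i j : ℕ, n₀ ≤ i ∧ i + 1 < j ∧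
    (∃ y, l[i]? = some y ∧ dist (pos δ y) x ≤ r) ∧
    (∃ y, l[j]? = some y ∧ R ≤ dist (pos δ y) x) ∧
    ∀ k, i < k → k < j → ∃ y, l[k]? = some y ∧ y ∈ C

/-- **Pinned inward bound = Condition G2 (constant form) for INWARD unforced crossings of the
critical hexagonal SAW, conditionally on any past.** There are a modulus `M > 1` and a lattice
cut-off `r₀ > 0` such that for every bounded `Ω`, mesh `δ > 0`, endpoints `a b`, past `π` (a vertex prefix),
annulus `A(x, r, Mr)` with `r ≥ r₀ δ` whose inner ball touches the slit domain's boundary, and every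
UNFORCED annulus component `C`: the `x_c`-weight of the walks `a → b` extending `π` whose future
crosses `C` inward is at most half the weight of all walks extending `π`.
(KS 2017 Condition G2 restricted to hitting-time pasts and split by direction; `1/2` is any constant
by KS Cor. 2.7.) Pinned at `b`: NOT reachable by the identity alone — see `stub_pinnedReturn_of`. -/
def PinnedReturnBound : Prop :=
  ∃ M r₀ : ℝ, 1 < M ∧ 0 < r₀ ∧ ∀ (Ω : Set ℂ), Bornology.IsBounded Ω → ∀ (δ : ℝ), 0 < δ →
    ∀ (a b : HexVertex) (π : List HexVertex) (hπ : π ≠ []) (x : ℂ) (r : ℝ), r₀ * δ ≤ r →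
      InnerTouchesBoundary Ω δ π x r →
      ∀ C : Set HexVertex, IsAnnulusComponent Ω δ π x r (M * r) C →
        Unforced Ω δ π (π.getLast hπ) b C →
          2 * hexSAWWeight Ω δ a b
              {γ | π <+: γ.walk.support ∧ FutureCrossesIn γ.walk.support (π.length - 1) C δ x r (M * r)} ≤
            hexSAWWeight Ω δ a b {γ | π <+: γ.walk.support}

/-- **Outward dive bound = Condition G2 (constant form) for OUTWARD unforced crossings** (re-ascents
into adjacent, possibly self-made, dead ends). Same quantifiers as `PinnedReturnBound` with
`FutureCrossesOut`. This half of G2 is NOT reachable by the strong-Markov identity (one-way far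
enders from a tip are not rare: `Σ_d d^{-15/16}` diverges), and neither half alone yields (H1) (an
arch created by one earlier excursion forces every later return, so an adversary oscillating under it
pays only for re-ascents; arch-free oscillations pay only for returns). Open, RSW-type, no FKG at
`n = 0`; the shared atom of the lines `reversal-virgin-disc` (`OneScaleDive`, dives INTO virgin
discs) and `domination-buys-tightness`. Size L. -/
def OutwardDiveBound : Prop :=
  ∃ M r₀ : ℝ, 1 < M ∧ 0 < r₀ ∧ ∀ (Ω : Set ℂ), Bornology.IsBounded Ω → ∀ (δ : ℝ), 0 < δ →
    ∀ (a b : HexVertex) (π : List HexVertex) (hπ : π ≠ []) (x : ℂ) (r : ℝ), r₀ * δ ≤ r →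
      InnerTouchesBoundary Ω δ π x r →
      ∀ C : Set HexVertex, IsAnnulusComponent Ω δ π x r (M * r) C →
        Unforced Ω δ π (π.getLast hπ) b C →
          2 * hexSAWWeight Ω δ a b
              {γ | π <+: γ.walk.support ∧ FutureCrossesOut γ.walk.support (π.length - 1) C δ x r (M * r)} ≤
            hexSAWWeight Ω δ a b {γ | π <+: γ.walk.support}

/-- The Aizenman–Burchard rung for every Dobrushin domain and every honest endpoint approximation —
EXACTLY the hypothesis of the disprover's PROVED `Disproof.crux_of_traversalBound` (§6). -/
def AllTraversalBound : Prop :=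
  ∀ (D : DobrushinDomain) (a b : ℝ → HexVertex),
    IsEmbEndpointApprox hexGraph hexCenter D a b → Disproof.HexTraversalBound D a b

/-! ## D. The registered stubs -/

/-- **stub 1 — the lever** (see `SignedVisitingBound`). Provable now; size M. Leans on:
`DuminilCopinSmirnov2012_lemma1_holds` (+ its subset variant via `HV.vertex_relation_of_wnd`),
`HexGreen.sum_relations_eq_hexFlux`, `HexGreen.term_add_term_swap`, `hexParafermionicObservable_self`,
`norm_hexParafermionicObservable_le`, `Literature.Probability.LatticeModels.winding`. -/
theorem stub_signedVisitingBound : SignedVisitingBound := by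
  sorry

/-- **stub 2 — (CD) far-mass decay** (see `FarMassDecay`). Open; observable-friendly (only ENDERS:
boundary values `|F| ≤ Z` of the observable from the tip); size M–L. -/
theorem stub_farMassDecay : FarMassDecay := by
  sorry

/-- **stub 3 — identity ⇒ inward visiting bound.** From the lever and (CD): apply
`SignedVisitingBound` in `Λ₂ = trunc Λ x R` (simply connected: complement = `Λᶜ ∪` exterior of the
disc) with `U ⊇ ballPart`, choose the phase `φ` per COHERENCE CLASS of exits, and control the
incoherent classes. WHY IT MIGHT FAIL (the card's falsifier (i), sharpened): from a tip, cells cut in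
the annulus by earlier arches give exit classes with windings `0, ±2π`, i.e. phases `0, ±3π/4`, NOT
in a half-plane, so ONE complex identity cannot bound the masses; intended repairs: (a) enlarge `U` to
`Λ₂ ∖ (own cell)` so that other cells' exits become WALL terms (one-way, covered by a strengthened
`FarMassDecay`: enders passing THROUGH the small ball), leaving only own-cell pockets; (b) two-class
half-plane trick (`0` and `+3π/4` alone are coherent); (c) flat re-basing of the source (companion
card `tip-renewal-complementarity`, itself crux-hard per triage). Size M–L. -/
theorem stub_ballReturn_of : SignedVisitingBound → FarMassDecay → BallReturnBound := by
  sorry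

/-- **stub 4 — the pinned transfer (+ dictionary).** From the far-mass-normalised inward bound on
induced lattice domains to the KS-form conditional bound for the walk PINNED at `b`
(`PinnedReturnBound`). Intended mechanism: decompose at the first passage of a cross-cut `K` between
the annulus and `b` (gluing at door mid-edges `≠ b`, the `RenewalGluingNe` shape of
`Theorems/HexTight/Negative/NotRenewalGluing`), and a CROSS-CUT BOUNDARY HARNACK inequality for SAW
partition functions `sup_{j ∈ K, prefixes} Z_{Λ∖prefix}(j → b) ≤ H · inf_{j ∈ K} Z(j → b)` at cuts of
bounded local modulus (continuum heuristic: conformal restriction covariance with exponent `5/8`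
makes the boundary Harnack principle conformally invariant, hence universal in simply connected
domains); alternatively the change of measure `P^{t→b}(E) = E_Q[1_E Y]/E_Q[Y]` + Hölder with the
rate form (RH′) `‖Y‖_p ≤ K (R/δ)^{c(p)} ‖Y‖_1`, `c(p) → 0` (triage r1-3; Gehring/A_∞ does NOT apply,
triage r1-1/2). Also owed here: the DICTIONARY `HexMidEdgeSAW` on induced `Finset` domains ↔ futures
of `hexDomainGraph Ω δ` given a prefix (equal when no `ℍ`-edge between two `Ω_δ`-faces is dropped —
eventually true for piecewise-smooth `∂Ω`, false near inward cusps / sub-mesh fingers of a wild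
Jordan domain: "walls ≠ pinholes", triage r1-3 (G2), shared by all four observable routes), and the
boundary-vs-interior endpoint glue (G1). WHY IT MIGHT FAIL: necks make `b` invisible (target mass ≪
far mass) exactly where the Harnack constant blows up; wild domains need a non-induced version of the
lever. Open; size L; the conceptually new stub of the line. -/
theorem stub_pinnedReturn_of : BallReturnBound → PinnedReturnBound := by
  sorry

/-- **stub 5 — outward unforced crossings, constant form** (see `OutwardDiveBound`). Open; size L;
hardest stub (the RSW content with no known tool at `n = 0`). -/
theorem stub_outwardDive : OutwardDiveBound := by
  sorry

/-- **stub 6 — Kemppainen–Smirnov / Aizenman–Burchard machinery.** From G2 in constant form (both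
directions, hitting-time pasts, modulus `M`, cut-off `r₀δ`) to AB99's (H1) `HexTraversalBound` for
every `(D, a, b)`: (i) constant ⇒ power by chaining across the `log_M(R/ρ)` nested annuli with
successive conditioning = nested prefix sets (KS Prop. 2.6 / Cor. 2.7; the Ising analogue in tree is
`IsingNestedConditioning` + `pow_pow_le_of_annuli29`); (ii) topology: of `k` separate traversals of
`D(x; ρ, R)` by a simple curve from `a δ` to `b δ` in `Ω_δ`, all but `k₀(x, ρ, R)` (forced by `∂Ω`,
finite for a Jordan domain, mesh-uniform for `δ ≤ δ₀(x,ρ,R)`… absorbed by the shell-dependent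
threshold, which may grow like `log(R/ρ)`) decompose into unforced inward/outward component
crossings at hitting times where the inner ball touches the past (KS §2.3, §3; AB99 App. A);
(iii) below `r₀δ` use the threshold (`≤ 338` faces within `2δ`, `Disproof.not_hasTraversals_sawCurve`).
Known-type; size L. -/
theorem stub_traversalBound_of : PinnedReturnBound → OutwardDiveBound → AllTraversalBound := by
  sorry

/-! ## E. Composition (kernel-checked): the six stubs close the crux BY NAME -/

/-- **`HexTight` from the six stubs**, through the PROVED Aizenman–Burchard rung
`Disproof.crux_of_traversalBound` (which is where `IsEmbEndpointApprox.tendsto_fst/snd` are used,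
honouring `Disproof.hexTight_false_without_endpointLimits`). -/
theorem HexTight_of
    (h₁ : SignedVisitingBound)
    (h₂ : FarMassDecay)
    (h₃ : SignedVisitingBound → FarMassDecay → BallReturnBound)
    (h₄ : BallReturnBound → PinnedReturnBound)
    (h₅ : OutwardDiveBound)
    (h₆ : PinnedReturnBound → OutwardDiveBound → AllTraversalBound) :
    Summit.CriticalPhenomena.SAWScalingLimit.Theses.SAWDevelopingMap.HexTight :=
  Disproof.crux_of_traversalBound (h₆ (h₄ (h₃ h₁ h₂)) h₅)

/-- The same composition for the copy of the crux in the route file that KEYS the item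
(`stmt-CriticalPhenomena-5423` ↦ `Theses/SAWResidueField.lean`; all route copies of `HexTight` are
syntactically equal, so this is `HexTight_of` up to unfolding). -/
theorem HexTight_of'
    (h₁ : SignedVisitingBound)
    (h₂ : FarMassDecay)
    (h₃ : SignedVisitingBound → FarMassDecay → BallReturnBound)
    (h₄ : BallReturnBound → PinnedReturnBound)
    (h₅ : OutwardDiveBound)
    (h₆ : PinnedReturnBound → OutwardDiveBound → AllTraversalBound) :
    Summit.CriticalPhenomena.SAWScalingLimit.Theses.SAWResidueField.HexTight :=
  fun D a b hab => HexTight_of h₁ h₂ h₃ h₄ h₅ h₆ D a b hab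

/-- **The line as it stands** (the shape the skeleton checker registers): the crux, by name, from
the six `sorry`'d stubs — `sorryAx` enters ONLY through `stub_*`. -/
theorem HexTight_proof : Summit.CriticalPhenomena.SAWScalingLimit.Theses.SAWResidueField.HexTight :=
  HexTight_of' stub_signedVisitingBound stub_farMassDecay stub_ballReturn_of stub_pinnedReturn_of
    stub_outwardDive stub_traversalBound_of

end Summit.CriticalPhenomena.SAWScalingLimit.Cruxes.HexTight.DifferentiatedSumRule
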